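import Mathlib
import HarnessLib
import Literature.Analysis.Convex.KrasnoselskijIteration
import Literature.Analysis.Convex.ConvexMetricProjection
import Literature.Analysis.Convex.MonotoneOperatorResolvent

/-!
# Douglas–Rachford splitting (Eckstein–Bertsekas 1992, §4)
# and the convex feasibility dictionary (Lindstrom–Sims 2020, §1)

Literature anchor (statements and proofs follow the sources; nothing here is new mathematics):

* [EB92] J. Eckstein, D. P. Bertsekas, *On the Douglas–Rachford splitting method and the proximal
  point algorithm for maximal monotone operators*, Math. Programming **55** (1992) 293–318,
  doi:10.1007/BF01581204 (bib key `EcksteinBertsekas1992`; held copy, `lit` key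
  `paper:doi-10-1007-bf01581204`, journal page = PDF page + 292): §4 "Decomposition:
  Douglas–Rachford splitting methods", pp. 303–308 — the Douglas–Rachford recursion (p. 303),
  the operators `G_{λ,A,B}` (p. 303) and `S_{λ,A,B}` (p. 304), Theorem 4, Corollary 4.1
  (Lions–Mercier), Theorem 5, Theorem 6, Corollary 6.1, Theorem 7.
* [LM79] P.-L. Lions, B. Mercier, *Splitting algorithms for the sum of two nonlinear operators*,
  SIAM J. Numer. Anal. **16** (1979) 964–979, doi:10.1137/0716071 (bib key `LionsMercier1979`) —
  the original source of Corollary 4.1 / Corollary 6.1, cited through [EB92] ("the key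
  Lions–Mercier result", p. 305) and [LS20, Thm 1.4].
* [LS20] S. B. Lindstrom, B. Sims, *Survey: sixty years of Douglas–Rachford*, J. Aust. Math.
  Soc. **110** (2021) 333–370, doi:10.1017/S1446788719000570, arXiv:1809.07181 (bib key
  `LindstromSims2020`; held copy, `lit` key `paper:arxiv-1809.07181`): §1.2 Definition 1.2
  (`T_{A,B} = ½(I + R_B R_A)`, `R_C = 2P_C − I`), §1.3 (the normal cone operator `N_C`, "the
  resolvents `J_{N_A}`, `J_{N_B}` are the projection operators `P_A`, `P_B`", Theorem 1.4 [LM79],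
  Theorem 1.5 [BCL04]), §3 Proposition 3.1 (fixed points of DR give solutions).

THE METHOD [EB92, §4, p. 303].  Fix `λ > 0` and two maximal monotone operators `A`, `B` on a
Hilbert space.  `{z^k}` obeys the DOUGLAS–RACHFORD RECURSION for `λ, A, B` if
`z^{k+1} = J_{λA}((2J_{λB} − I)(z^k)) + (I − J_{λB})(z^k)`, where `J_{λT} = (I + λT)⁻¹` is the
resolvent.  With `G_{λ,A,B} = J_{λA} ∘ (2J_{λB} − I) + (I − J_{λB})
= {(u + λb, v + λb) | (u, b) ∈ B, (v, a) ∈ A, v + λa = u − λb}` and the SPLITTING OPERATOR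
`S_{λ,A,B} = G_{λ,A,B}⁻¹ − I = {(v + λb, u − v) | (u, b) ∈ B, (v, a) ∈ A, v + λa = u − λb}`
(p. 304): `S` is monotone when `A`, `B` are, and maximal when they are (Thm 4); `G = (I + S)⁻¹` is
firmly nonexpansive with full domain (Cor 4.1, Lions–Mercier); `zer S = {u + λb | b ∈ Bu,
−b ∈ Au} ⊆ {u + λb | u ∈ zer(A + B), b ∈ Bu}` (Thm 5); the recursion is the proximal point
algorithm for `S` with stepsize 1 (Thm 6); hence if `A + B` has a zero, `z^k` converges (weakly)
to some `z ∈ zer S` and `x^k = J_{λB}(z^k)` to the zero `J_{λB} z` of `A + B` (Cor 6.1, [LM79]),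
also with relaxation factors `ρ_k ∈ (0, 2)` (Thm 7).

## What is formalised (namespace `Literature.Analysis.Convex.DouglasRachford`)

Operators are subsets of `H × H` over a real inner product space, as in
`Literature.Analysis.Convex.MonotoneOperator` ([EB92, §2]); the source's `λ` is `γ : ℝ`.

* `drGraph γ A B` (`G_{λ,A,B}` as a set, p. 303), `splitting γ A B` (`S_{λ,A,B}`, p. 304),
  `resolvent_one_splitting` (`(I + S)⁻¹ = G`, i.e. `J_{1·S} = G` — Theorem 6 at the level of
  graphs) and `splitting_eq_invSubId_drGraph` (`S = G⁻¹ − I`).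
* Theorem 4: `isMonotone_splitting` (with the identity of its proof,
  `inner_splitting_eq`: `⟨(v' + λb') − (v + λb), (u' − v') − (u − v)⟩
  = λ⟨v' − v, a' − a⟩ + λ⟨b' − b, u' − u⟩`), `isMaximalMonotone_splitting` (maximality from
  `im(I + S) = 𝓗`, which holds as soon as `J_{λA}`, `J_{λB}` are everywhere defined).
* Corollary 4.1 [LM79]: `isFirmlyNonexpansive_drGraph` (for monotone `A`, `B`).
* FUNCTION FORM (resolvent maps `ja = J_{λA}`, `jb = J_{λB}` given as data,
  `IsResolventMap γ A ja`, `IsResolventMap γ B jb` — this is what maximality provides, see the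
  companion file): `drStep ja jb z = ja (2 jb z − z) + (z − jb z)` (the recursion, p. 303) and
  `drIter` (its iterates); the identities `(I − J_{λB}) z = λb`, `(2J_{λB} − I) z = x − λb` for
  `(x, b) ∈ B`, `x + λb = z` (p. 303: `self_sub_apply_eq`, `two_smul_apply_sub_eq`);
  `graph_drStep` (`graph (drStep ja jb) = G_{λ,A,B}`, the set expression of p. 303) and
  `hasFullDomain_drGraph`; Theorem 6 in function form `isResolventMap_drStep` (the DR step IS the
  resolvent map of `S_{λ,A,B}` with stepsize 1); Cor 4.1 in function form
  `norm_drStep_sub_sq_le_inner` / `norm_drStep_sub_le`; `reflComp` (`R_A ∘ R_B` with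
  `R = 2J − I`, nonexpansive: `norm_reflComp_sub_le`), `two_smul_drStep` / `drStep_eq_half_smul` /
  `drStep_eq_averagedMap` (`G = ½(R_A R_B + I)`, [LS20, Def 1.2]), `drIter_eq_kmIter` and
  `reflComp_eq_self_iff` (`Fix (R_A R_B) = Fix G`).
* Theorem 5: `zer_splitting` (`zer S = {u + λb | (u, b) ∈ B, (u, −b) ∈ A}`),
  `zer_splitting_subset` (`⊆ {u + λb | u ∈ zer(A + B), b ∈ Bu}`), `image_zer_splitting`
  (`J_{λB}(zer S) = zer(A + B)`), `drStep_eq_self_iff` (`Fix G = zer S`, Lemma 2),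
  `apply_mem_zer_opSum_of_drStep_eq_self` ("given any zero `z` of `S_{λ,A,B}`, `J_{λB}(z)` is a
  zero of `A + B`", p. 305; [LS20, Prop 3.1]) and its converse
  `exists_drStep_eq_self_of_mem_zer`.
* Corollary 6.1 [LM79] RESTRICTED to strong convergence on a proper (e.g. finite-dimensional)
  space with exact resolvents: `exists_tendsto_drIter` — if `zer(A + B) ≠ ∅` the DR iterates
  converge to a fixed point `z` of `G`, and `x^k = J_{λB} z^k → J_{λB} z ∈ zer(A + B)`; and
  Theorem 7 likewise restricted (constant relaxation `ρ ∈ (0, 2)`, `α_k = β_k = 0`):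
  `exists_tendsto_kmIter_drStep` for `z^{k+1} = (1 − ρ) z^k + ρ G(z^k)`.
* THE FEASIBILITY DICTIONARY [LS20, §1.3]: `normalCone C` (the normal cone operator `N_C`),
  `dom_normalCone`, `isMonotone_normalCone`, `isResolventMap_proj` /
  `resolvent_normalCone_eq_graph_proj` ("the resolvents `J_{N_C}^λ` are the projection operators
  `P_C`", for `C` nonempty complete convex and every `λ > 0`), `isMaximalMonotone_normalCone`,
  `zer_opSum_normalCone` (`zer(N_A + N_B) = A ∩ B`: the feasibility problem (2) as the inclusion
  (3)), `drStep_proj_eq` (`T_{A,B} = ½(R_B R_A + I)` of Definition 1.2 is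
  `drStep (proj B) (proj A)`), Proposition 3.1 in
  the convex case (`proj_mem_inter_of_drStep_eq_self`: `x ∈ Fix T_{A,B} ⟹ P_A x ∈ A ∩ B`), and
  Theorem 1.5 [BCL04] in finite dimension with strong convergence
  (`exists_tendsto_drIter_proj`: `A ∩ B ≠ ∅ ⟹ x_n → x ∈ Fix T_{A,B}` with `P_A x ∈ A ∩ B`, and the
  "shadow" `P_A x_n → P_A x`).

Everything is proved; there are no named facts and no `sorry`.

## Conventions and deviations

* MAXIMALITY.  As in the companion file, "maximal monotone `A`, `B`" is replaced by "monotone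
  `A`, `B` with resolvent maps `ja`, `jb`" (Minty's theorem is what makes the two equivalent and
  is not formalised); for normal cones of nonempty complete convex sets the resolvent maps are the
  metric projections of `Literature.Analysis.Convex.ConvexMetricProjection`, constructed here, so
  the feasibility statements are unconditional.
* CONVERGENCE is strong convergence on a `ProperSpace` (finite dimension); the weak convergence of
  Cor 6.1 / Thm 7 / [LS20, Thm 1.4, Thm 1.5] in a general Hilbert space, the error sequences
  `α_k`, `β_k` and varying `ρ_k` of Theorem 7, Corollary 6.2 (unboundedness when
  `zer(A + B) = ∅`), the discussion of stepsizes `c ≠ 1` (p. 306), §5 (partial inverses,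
  generalized ADMM) and §6 are NOT formalised.  [LS20, Prop 3.1] is stated there for proximal
  (possibly non-convex) sets with set-valued projections; here only the convex single-valued case.
-/

noncomputable section

open Filter Topology
open scoped RealInnerProductSpace
open Literature.Analysis.Convex.KrasnoselskijIteration
open Literature.Analysis.Convex.ConvexMetricProjection
open Literature.Analysis.Convex.MonotoneOperator

namespace Literature.Analysis.Convex.DouglasRachford

variable {H : Type*} [NormedAddCommGroup H] [InnerProductSpace ℝ H]

/-! ## The operators `G_{λ,A,B}` and `S_{λ,A,B}` [EB92, §4, pp. 303–304] -/

/-- `G_{λ,A,B} = {(u + λb, v + λb) | (u, b) ∈ B, (v, a) ∈ A, v + λa = u − λb}`, the set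
expression for `J_{λA} ∘ (2J_{λB} − I) + (I − J_{λB})`. [cite: EcksteinBertsekas1992, §4 p. 303] -/
def drGraph (γ : ℝ) (A B : Set (H × H)) : Set (H × H) :=
  {p | ∃ u b v a, (u, b) ∈ B ∧ (v, a) ∈ A ∧ v + γ • a = u - γ • b ∧
    p.1 = u + γ • b ∧ p.2 = v + γ • b}

/-- The **splitting operator** `S_{λ,A,B} = G_{λ,A,B}⁻¹ − I
= {(v + λb, u − v) | (u, b) ∈ B, (v, a) ∈ A, v + λa = u − λb}` of `A` and `B` with respect
to `λ`. [cite: EcksteinBertsekas1992, §4 p. 304] -/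
def splitting (γ : ℝ) (A B : Set (H × H)) : Set (H × H) :=
  {p | ∃ u b v a, (u, b) ∈ B ∧ (v, a) ∈ A ∧ v + γ • a = u - γ • b ∧
    p.1 = v + γ • b ∧ p.2 = u - v}

variable {γ : ℝ} {A B : Set (H × H)} {ja jb : H → H} {x z w : H}

/-- Membership in `G_{λ,A,B}`. [cite: EcksteinBertsekas1992, §4 p. 303] -/
theorem mem_drGraph_iff : (z, w) ∈ drGraph γ A B ↔
    ∃ u b v a, (u, b) ∈ B ∧ (v, a) ∈ A ∧ v + γ • a = u - γ • b ∧
      z = u + γ • b ∧ w = v + γ • b :=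
  Iff.rfl

/-- Membership in `S_{λ,A,B}`. [cite: EcksteinBertsekas1992, §4 p. 304] -/
theorem mem_splitting_iff : (z, w) ∈ splitting γ A B ↔
    ∃ u b v a, (u, b) ∈ B ∧ (v, a) ∈ A ∧ v + γ • a = u - γ • b ∧
      z = v + γ • b ∧ w = u - v :=
  Iff.rfl

/-- **Theorem 6 (graph level)**: `(I + S_{λ,A,B})⁻¹ = G_{λ,A,B}`, i.e. the resolvent of the
splitting operator with stepsize `1` is the Douglas–Rachford operator ("a simple manipulation",
p. 304). [cite: EcksteinBertsekas1992, §4 Thm 6] -/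
theorem resolvent_one_splitting (γ : ℝ) (A B : Set (H × H)) :
    resolvent 1 (splitting γ A B) = drGraph γ A B := by
  ext ⟨z, w⟩
  rw [mem_resolvent_iff, mem_drGraph_iff]
  constructor
  · rintro ⟨y, hy, e⟩
    obtain ⟨u, b, v, a, hb, ha, h, rfl, rfl⟩ := mem_splitting_iff.1 hy
    refine ⟨u, b, v, a, hb, ha, h, ?_, rfl⟩
    rw [← e, one_smul]; abel
  · rintro ⟨u, b, v, a, hb, ha, h, rfl, rfl⟩
    exact ⟨u - v, mem_splitting_iff.2 ⟨u, b, v, a, hb, ha, h, rfl, rfl⟩, by rw [one_smul]; abel⟩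

/-- `S_{λ,A,B} = G_{λ,A,B}⁻¹ − I`. [cite: EcksteinBertsekas1992, §4 p. 304] -/
theorem splitting_eq_invSubId_drGraph (γ : ℝ) (A B : Set (H × H)) :
    splitting γ A B = invSubId (drGraph γ A B) := by
  ext ⟨z, w⟩
  rw [mem_splitting_iff, mem_invSubId_iff]
  constructor
  · rintro ⟨u, b, v, a, hb, ha, h, rfl, rfl⟩
    exact ⟨u + γ • b, mem_drGraph_iff.2 ⟨u, b, v, a, hb, ha, h, rfl, rfl⟩, by abel⟩
  · rintro ⟨y, hy, rfl⟩
    obtain ⟨u, b, v, a, hb, ha, h, rfl, rfl⟩ := mem_drGraph_iff.1 hy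
    exact ⟨u, b, v, a, hb, ha, h, rfl, by abel⟩

/-! ## Theorem 4 and Corollary 4.1 [EB92, pp. 304–305] -/

/-- `⟨p + γr, q − p⟩ = ⟨p, q − γr − p⟩ + γ⟨r, q⟩` (bilinearity; the rearrangement used in
the proof of Theorem 4). [folklore] -/
private theorem inner_add_smul_sub_eq (γ : ℝ) (p q r : H) :
    ⟪p + γ • r, q - p⟫ = ⟪p, q - γ • r - p⟫ + γ * ⟪r, q⟫ := by
  simp only [inner_add_left, inner_sub_right, real_inner_smul_left, real_inner_smul_right]
  linear_combination (-γ) * real_inner_comm p r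

/-- The identity in the proof of Theorem 4: for `(u, b), (u', b') ∈ B`, `(v, a), (v', a') ∈ A` with
`v + λa = u − λb`, `v' + λa' = u' − λb'`,
`⟨(v' + λb') − (v + λb), (u' − v') − (u − v)⟩ = λ⟨v' − v, a' − a⟩ + λ⟨b' − b, u' − u⟩`.
[cite: EcksteinBertsekas1992, §4 Thm 4] -/
theorem inner_splitting_eq {u b v a u' b' v' a' : H} (h : v + γ • a = u - γ • b)
    (h' : v' + γ • a' = u' - γ • b') :
    ⟪(v' + γ • b') - (v + γ • b), (u' - v') - (u - v)⟫
      = γ * ⟪v' - v, a' - a⟫ + γ * ⟪b' - b, u' - u⟫ := by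
  have e1 : (v' + γ • b') - (v + γ • b) = (v' - v) + γ • (b' - b) := by
    rw [smul_sub]; abel
  have e2 : (u' - v') - (u - v) = (u' - u) - (v' - v) := by abel
  have e3 : γ • (a' - a) = (u' - u) - γ • (b' - b) - (v' - v) := by
    rw [smul_sub, eq_sub_of_add_eq' h, eq_sub_of_add_eq' h', smul_sub]; abel
  rw [e1, e2, inner_add_smul_sub_eq, ← e3, real_inner_smul_right]

/-- **Theorem 4 (first part)**: if `A` and `B` are monotone (and `λ > 0`) then `S_{λ,A,B}` is
monotone. [cite: EcksteinBertsekas1992, §4 Thm 4] -/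
theorem isMonotone_splitting (hA : IsMonotone A) (hB : IsMonotone B) (hγ : 0 < γ) :
    IsMonotone (splitting γ A B) := by
  intro z w hzw z' w' hzw'
  obtain ⟨u, b, v, a, hb, ha, h, rfl, rfl⟩ := mem_splitting_iff.1 hzw
  obtain ⟨u', b', v', a', hb', ha', h', rfl, rfl⟩ := mem_splitting_iff.1 hzw'
  rw [inner_splitting_eq h h', real_inner_comm (u' - u) (b' - b)]
  exact add_nonneg (mul_nonneg hγ.le (hA ha ha')) (mul_nonneg hγ.le (hB hb hb'))

/-- **Theorem 4 (second part)**: `S_{λ,A,B}` is maximal monotone as soon as `A`, `B` are monotone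
with `im(I + λA) = im(I + λB) = 𝓗` (which is what maximality of `A` and `B` provides through
Minty's theorem): then `(I + S)⁻¹ = G` has full domain. [cite: EcksteinBertsekas1992, §4 Thm 4] -/
theorem isMaximalMonotone_splitting (hA : IsMonotone A) (hB : IsMonotone B) (hγ : 0 < γ)
    (hfa : ∀ z : H, ∃ x y, (x, y) ∈ A ∧ x + γ • y = z)
    (hfb : ∀ z : H, ∃ x y, (x, y) ∈ B ∧ x + γ • y = z) :
    IsMaximalMonotone (splitting γ A B) := by
  refine isMaximalMonotone_of_forall_exists (isMonotone_splitting hA hB hγ) one_pos fun z => ?_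
  obtain ⟨u, b, hb, hu⟩ := hfb z
  obtain ⟨v, a, ha, hv⟩ := hfa (u - γ • b)
  exact ⟨v + γ • b, u - v, mem_splitting_iff.2 ⟨u, b, v, a, hb, ha, hv, rfl, rfl⟩,
    by rw [one_smul, ← hu]; abel⟩

/-- **Corollary 4.1 (Lions–Mercier)**: for monotone `A`, `B` the operator
`G_{λ,A,B} = (I + S_{λ,A,B})⁻¹` is firmly nonexpansive.
[cite: EcksteinBertsekas1992, §4 Cor 4.1] -/
theorem isFirmlyNonexpansive_drGraph (hA : IsMonotone A) (hB : IsMonotone B) (hγ : 0 < γ) :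
    IsFirmlyNonexpansive (drGraph γ A B) := by
  rw [← resolvent_one_splitting]
  exact (isMonotone_iff_isFirmlyNonexpansive_resolvent one_pos).1 (isMonotone_splitting hA hB hγ)

/-! ## The recursion in function form [EB92, p. 303] -/

/-- One step of the **Douglas–Rachford recursion** for `λ, A, B`, written with the resolvent maps
`ja = J_{λA}`, `jb = J_{λB}`: `z ↦ J_{λA}((2J_{λB} − I) z) + (I − J_{λB}) z`, i.e. the operator
`G_{λ,A,B} = J_{λA} ∘ (2J_{λB} − I) + (I − J_{λB})` as a map.
[cite: EcksteinBertsekas1992, §4 p. 303] -/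
def drStep (ja jb : H → H) (z : H) : H := ja ((2 : ℝ) • jb z - z) + (z - jb z)

/-- The Douglas–Rachford iterates `z^k = G^k(z^0)`. [cite: EcksteinBertsekas1992, §4 p. 303] -/
def drIter (ja jb : H → H) (z₀ : H) (n : ℕ) : H := (drStep ja jb)^[n] z₀

/-- The composition `R_{λA} ∘ R_{λB}` of the reflections `R = 2J − I` (the nonexpansive `C` with
`G_{λ,A,B} = ½(C + I)` of Lemma 1 (iii); [LS20, Def 1.2] "reflect-reflect-average").
[cite: LindstromSims2020, Def 1.2] -/
def reflComp (ja jb : H → H) (z : H) : H :=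
  (2 : ℝ) • ja ((2 : ℝ) • jb z - z) - ((2 : ℝ) • jb z - z)

/-- `z^0 = z₀`. [cite: EcksteinBertsekas1992, §4 p. 303] -/
@[simp] theorem drIter_zero (ja jb : H → H) (z₀ : H) : drIter ja jb z₀ 0 = z₀ := rfl

/-- `z^{k+1} = G(z^k)`. [cite: EcksteinBertsekas1992, §4 p. 303] -/
theorem drIter_succ (ja jb : H → H) (z₀ : H) (n : ℕ) :
    drIter ja jb z₀ (n + 1) = drStep ja jb (drIter ja jb z₀ n) :=
  Function.iterate_succ_apply' _ _ _

/-- `2 G z = z + R_A R_B z`. [cite: LindstromSims2020, Def 1.2] -/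
theorem two_smul_drStep (ja jb : H → H) (z : H) :
    (2 : ℝ) • drStep ja jb z = z + reflComp ja jb z := by
  simp only [reflComp, drStep, two_smul]
  abel

/-- Pointwise: `G z = ½(z + R_A R_B z)`. [cite: LindstromSims2020, Def 1.2] -/
theorem drStep_eq_half_smul (ja jb : H → H) (z : H) :
    drStep ja jb z = (1 / 2 : ℝ) • (z + reflComp ja jb z) := by
  rw [← two_smul_drStep, smul_smul, show (1 / 2 : ℝ) * 2 = 1 by norm_num, one_smul]

/-- `G = ½(R_A R_B + I)`: the Douglas–Rachford step is the Krasnoselskij averaged map of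
`R_{λA} ∘ R_{λB}` with parameter `½`. [cite: LindstromSims2020, Def 1.2] -/
theorem drStep_eq_averagedMap (ja jb : H → H) :
    drStep ja jb = averagedMap (reflComp ja jb) (1 / 2) := by
  funext z
  rw [averagedMap, show (1 - 1 / 2 : ℝ) = 1 / 2 by norm_num, ← smul_add, drStep_eq_half_smul]

/-- The Douglas–Rachford iterates are the Krasnoselskij iterates of `R_{λA} ∘ R_{λB}` with
parameter `½`. [cite: LindstromSims2020, Def 1.2] -/
theorem drIter_eq_kmIter (ja jb : H → H) (z₀ : H) :
    drIter ja jb z₀ = kmIter (reflComp ja jb) (1 / 2) z₀ := by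
  funext n
  simp only [drIter, kmIter, drStep_eq_averagedMap]

/-- `G z = z ⟺ (R_A R_B) z = z`. [cite: LindstromSims2020, Def 1.2] -/
theorem reflComp_eq_self_iff (ja jb : H → H) : reflComp ja jb z = z ↔ drStep ja jb z = z := by
  rw [drStep_eq_averagedMap, averagedMap_eq_self_iff (by norm_num : (1 / 2 : ℝ) ≠ 0)]

/-- `(I − J_{λB})(z) = λb` for the unique `(x, b) ∈ B` with `x + λb = z` (first identity of
p. 303). [cite: EcksteinBertsekas1992, §4 p. 303] -/
theorem self_sub_apply_eq (hjb : IsResolventMap γ B jb) (hB : IsMonotone B) (hγ : 0 < γ) {b : H}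
    (hxb : (x, b) ∈ B) (hz : x + γ • b = z) : z - jb z = γ • b := by
  rw [← hz, hjb.apply_add_smul hB hγ hxb, add_sub_cancel_left]

/-- `(2J_{λB} − I)(z) = x − λb` for the unique `(x, b) ∈ B` with `x + λb = z` (second identity of
p. 303). [cite: EcksteinBertsekas1992, §4 p. 303] -/
theorem two_smul_apply_sub_eq (hjb : IsResolventMap γ B jb) (hB : IsMonotone B) (hγ : 0 < γ)
    {b : H} (hxb : (x, b) ∈ B) (hz : x + γ • b = z) : (2 : ℝ) • jb z - z = x - γ • b := by
  rw [← hz, hjb.apply_add_smul hB hγ hxb, two_smul]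
  abel

/-- **The set expression for `G_{λ,A,B}`** (p. 303, "following the algorithmic description
(a)–(b)"): the graph of the Douglas–Rachford step is `G_{λ,A,B}`.
[cite: EcksteinBertsekas1992, §4 p. 303] -/
theorem graph_drStep (hja : IsResolventMap γ A ja) (hjb : IsResolventMap γ B jb)
    (hA : IsMonotone A) (hB : IsMonotone B) (hγ : 0 < γ) :
    graph (drStep ja jb) = drGraph γ A B := by
  ext ⟨z, w⟩
  rw [mem_graph_iff, mem_drGraph_iff]
  constructor
  · rintro rfl
    obtain ⟨b, hb, hu⟩ := hjb.exists_mem z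
    obtain ⟨a, ha, hv⟩ := hja.exists_mem ((2 : ℝ) • jb z - z)
    refine ⟨jb z, b, ja ((2 : ℝ) • jb z - z), a, hb, ha,
      hv.trans (two_smul_apply_sub_eq hjb hB hγ hb hu), hu.symm, ?_⟩
    rw [drStep, self_sub_apply_eq hjb hB hγ hb hu]
  · rintro ⟨u, b, v, a, hb, ha, h, rfl, rfl⟩
    have hv : ja (u - γ • b) = v := by rw [← h]; exact hja.apply_add_smul hA hγ ha
    rw [drStep, two_smul_apply_sub_eq hjb hB hγ hb rfl, self_sub_apply_eq hjb hB hγ hb rfl, hv]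

/-- **Theorem 6 (function form)**: the Douglas–Rachford step is the resolvent map, with stepsize
`1`, of the splitting operator: "the Douglas–Rachford iteration `z^{k+1} = G_{λ,A,B}(z^k)` … is
just `z^{k+1} = (I + S_{λ,A,B})⁻¹(z^k)`". [cite: EcksteinBertsekas1992, §4 Thm 6] -/
theorem isResolventMap_drStep (hja : IsResolventMap γ A ja) (hjb : IsResolventMap γ B jb)
    (hA : IsMonotone A) (hB : IsMonotone B) (hγ : 0 < γ) :
    IsResolventMap 1 (splitting γ A B) (drStep ja jb) := by
  intro z
  rw [resolvent_one_splitting, ← graph_drStep hja hjb hA hB hγ]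
  exact mem_graph_iff.2 rfl

/-- `G_{λ,A,B}` has full domain ("as `J_{λA}` and `J_{λB}` are defined everywhere", end of the proof
of Theorem 4). [cite: EcksteinBertsekas1992, §4 Thm 4] -/
theorem hasFullDomain_drGraph (hja : IsResolventMap γ A ja) (hjb : IsResolventMap γ B jb)
    (hA : IsMonotone A) (hB : IsMonotone B) (hγ : 0 < γ) : HasFullDomain (drGraph γ A B) := by
  rw [← graph_drStep hja hjb hA hB hγ]
  exact hasFullDomain_graph _

/-- **Corollary 4.1 (function form)**: the Douglas–Rachford step is firmly nonexpansive,
`‖G z' − G z‖² ≤ ⟨z' − z, G z' − G z⟩` ("Lions and Mercier showed that `G_{λ,A,B}` is firmly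
nonexpansive, from which they obtained convergence", p. 303).
[cite: EcksteinBertsekas1992, §4 Cor 4.1] -/
theorem norm_drStep_sub_sq_le_inner (hja : IsResolventMap γ A ja) (hjb : IsResolventMap γ B jb)
    (hA : IsMonotone A) (hB : IsMonotone B) (hγ : 0 < γ) (z z' : H) :
    ‖drStep ja jb z' - drStep ja jb z‖ ^ 2 ≤ ⟪z' - z, drStep ja jb z' - drStep ja jb z⟫ :=
  (isResolventMap_drStep hja hjb hA hB hγ).norm_sub_sq_le_inner (isMonotone_splitting hA hB hγ)
    one_pos z z'

/-- The Douglas–Rachford step is nonexpansive. [cite: EcksteinBertsekas1992, §4 Cor 4.1] -/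
theorem norm_drStep_sub_le (hja : IsResolventMap γ A ja) (hjb : IsResolventMap γ B jb)
    (hA : IsMonotone A) (hB : IsMonotone B) (hγ : 0 < γ) (z z' : H) :
    ‖drStep ja jb z' - drStep ja jb z‖ ≤ ‖z' - z‖ :=
  (isResolventMap_drStep hja hjb hA hB hγ).norm_sub_le (isMonotone_splitting hA hB hγ) one_pos z z'

/-- `R_{λA} ∘ R_{λB}` is nonexpansive (composition of two nonexpansive reflections, Lemma 1 (ii)).
[cite: EcksteinBertsekas1992, §2 Lemma 1 (ii) and §4 p. 303] -/
theorem norm_reflComp_sub_le (hja : IsResolventMap γ A ja) (hjb : IsResolventMap γ B jb)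
    (hA : IsMonotone A) (hB : IsMonotone B) (hγ : 0 < γ) (x y : H) :
    ‖reflComp ja jb x - reflComp ja jb y‖ ≤ ‖x - y‖ :=
  (hja.norm_reflect_sub_le hA hγ _ _).trans (hjb.norm_reflect_sub_le hB hγ y x)

/-! ## Theorem 5: zeroes of `S_{λ,A,B}` and of `A + B` [EB92, p. 305] -/

/-- **Theorem 5**: `zer(S_{λ,A,B}) = Z* = {u + λb | b ∈ Bu, −b ∈ Au}` (`λ ≠ 0`).
[cite: EcksteinBertsekas1992, §4 Thm 5] -/
theorem zer_splitting (hγ : γ ≠ 0) (A B : Set (H × H)) :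
    zer (splitting γ A B) = {z | ∃ u b, (u, b) ∈ B ∧ (u, -b) ∈ A ∧ z = u + γ • b} := by
  ext z
  rw [mem_zer_iff, mem_splitting_iff, Set.mem_setOf_eq]
  constructor
  · rintro ⟨u, b, v, a, hb, ha, h, rfl, h0⟩
    have huv : u = v := sub_eq_zero.1 h0.symm
    subst huv
    have h2 : γ • a = γ • (-b) :=
      (add_left_cancel (h.trans (sub_eq_add_neg _ _))).trans (smul_neg γ b).symm
    have hab : a = -b := smul_right_injective H hγ h2
    subst hab
    exact ⟨_, b, hb, ha, rfl⟩
  · rintro ⟨u, b, hb, ha, rfl⟩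
    exact ⟨u, b, u, -b, hb, ha, by rw [smul_neg, sub_eq_add_neg], rfl, (sub_self u).symm⟩

/-- **Theorem 5, the inclusion**: `Z* ⊆ {u + λb | u ∈ zer(A + B), b ∈ Bu}`.
[cite: EcksteinBertsekas1992, §4 Thm 5] -/
theorem zer_splitting_subset (hγ : γ ≠ 0) (A B : Set (H × H)) :
    zer (splitting γ A B) ⊆ {z | ∃ u b, u ∈ zer (opSum A B) ∧ (u, b) ∈ B ∧ z = u + γ • b} := by
  rw [zer_splitting hγ]
  rintro z ⟨u, b, hb, ha, rfl⟩
  exact ⟨u, b, mem_zer_opSum_iff.2 ⟨b, hb, ha⟩, hb, rfl⟩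

/-- "Thus, given any zero `z` of `S_{λ,A,B}`, `J_{λB}(z)` is a zero of `A + B`" — and conversely
every zero of `A + B` arises this way: `J_{λB}(zer S_{λ,A,B}) = zer(A + B)`.
[cite: EcksteinBertsekas1992, §4 Thm 5] -/
theorem image_zer_splitting (hjb : IsResolventMap γ B jb) (hB : IsMonotone B) (hγ : 0 < γ)
    (A : Set (H × H)) : jb '' zer (splitting γ A B) = zer (opSum A B) := by
  ext x
  rw [zer_splitting hγ.ne', mem_zer_opSum_iff, Set.mem_image]
  constructor
  · rintro ⟨z, ⟨u, b, hb, ha, rfl⟩, rfl⟩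
    rw [hjb.apply_add_smul hB hγ hb]
    exact ⟨b, hb, ha⟩
  · rintro ⟨b, hb, ha⟩
    exact ⟨x + γ • b, ⟨x, b, hb, ha, rfl⟩, hjb.apply_add_smul hB hγ hb⟩

/-- The fixed points of the Douglas–Rachford step are the zeroes of the splitting operator
(Lemma 2 for `S_{λ,A,B}`, via Theorem 6). [cite: EcksteinBertsekas1992, §4 Thm 5 and Thm 6] -/
theorem drStep_eq_self_iff (hja : IsResolventMap γ A ja) (hjb : IsResolventMap γ B jb)
    (hA : IsMonotone A) (hB : IsMonotone B) (hγ : 0 < γ) :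
    drStep ja jb z = z ↔ z ∈ zer (splitting γ A B) :=
  (isResolventMap_drStep hja hjb hA hB hγ).apply_eq_self_iff (isMonotone_splitting hA hB hγ)
    one_pos

/-- A fixed point `z` of the Douglas–Rachford step yields the zero `J_{λB}(z)` of `A + B`
([LS20, Prop 3.1] in the operator setting). [cite: EcksteinBertsekas1992, §4 Thm 5] -/
theorem apply_mem_zer_opSum_of_drStep_eq_self (hja : IsResolventMap γ A ja)
    (hjb : IsResolventMap γ B jb) (hA : IsMonotone A) (hB : IsMonotone B) (hγ : 0 < γ)
    (h : drStep ja jb z = z) : jb z ∈ zer (opSum A B) := by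
  rw [← image_zer_splitting hjb hB hγ A]
  exact ⟨z, (drStep_eq_self_iff hja hjb hA hB hγ).1 h, rfl⟩

/-- Conversely every zero `x` of `A + B` is `J_{λB}(z)` for a fixed point `z` of the
Douglas–Rachford step. [cite: EcksteinBertsekas1992, §4 Thm 5] -/
theorem exists_drStep_eq_self_of_mem_zer (hja : IsResolventMap γ A ja)
    (hjb : IsResolventMap γ B jb) (hA : IsMonotone A) (hB : IsMonotone B) (hγ : 0 < γ)
    (hx : x ∈ zer (opSum A B)) : ∃ z, drStep ja jb z = z ∧ jb z = x := by
  rw [← image_zer_splitting hjb hB hγ A] at hx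
  obtain ⟨z, hz, rfl⟩ := hx
  exact ⟨z, (drStep_eq_self_iff hja hjb hA hB hγ).2 hz, rfl⟩

/-! ## Corollary 6.1 and Theorem 7 (restricted) [EB92, pp. 305–308] -/

/-- **Corollary 6.1 (Lions–Mercier [LM79]), strong form on a proper space**: if `A + B` has a
zero then the Douglas–Rachford iterates `z^k` converge to a limit `z` with `G z = z` (so
`z = u + λb`, `b ∈ Bu`, `−b ∈ Au`), and `x^k = J_{λB}(z^k)` converges to the zero `J_{λB} z` of
`A + B` ("in view of Theorem 3, Theorem 5, and the Lipschitz continuity of `J_{λB}`").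
[cite: EcksteinBertsekas1992, §4 Cor 6.1] -/
theorem exists_tendsto_drIter [ProperSpace H] (hja : IsResolventMap γ A ja)
    (hjb : IsResolventMap γ B jb) (hA : IsMonotone A) (hB : IsMonotone B) (hγ : 0 < γ)
    (hzer : (zer (opSum A B)).Nonempty) (z₀ : H) :
    ∃ z, drStep ja jb z = z ∧ jb z ∈ zer (opSum A B) ∧ Tendsto (drIter ja jb z₀) atTop (𝓝 z) ∧
      Tendsto (fun n => jb (drIter ja jb z₀ n)) atTop (𝓝 (jb z)) := by
  obtain ⟨x, hx⟩ := hzer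
  obtain ⟨p, hp, -⟩ := exists_drStep_eq_self_of_mem_zer hja hjb hA hB hγ hx
  obtain ⟨q, hq, hlim⟩ := exists_tendsto_kmIter (T := reflComp ja jb) (t := 1 / 2)
    (norm_reflComp_sub_le hja hjb hA hB hγ) ⟨p, (reflComp_eq_self_iff ja jb).2 hp⟩
    (by norm_num) (by norm_num) z₀
  rw [← drIter_eq_kmIter] at hlim
  have hq' : drStep ja jb q = q := (reflComp_eq_self_iff ja jb).1 hq
  exact ⟨q, hq', apply_mem_zer_opSum_of_drStep_eq_self hja hjb hA hB hγ hq', hlim,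
    ((hjb.continuous hB hγ).tendsto q).comp hlim⟩

/-- **Theorem 7 (restricted: exact resolvents `α_k = β_k = 0`, constant relaxation
`ρ ∈ (0, 2)`, proper space)**: the GENERALIZED Douglas–Rachford iteration
`z^{k+1} = (1 − ρ) z^k + ρ G_{λ,A,B}(z^k)` (i.e. `kmIter (drStep ja jb) ρ`) converges, when
`zer(A + B) ≠ ∅`, to some `z ∈ Z*` (a fixed point of `G`), and `J_{λB} z^k → J_{λB} z ∈ zer(A + B)`
("the conclusion then follows from Theorems 3 and 5"). [cite: EcksteinBertsekas1992, §4 Thm 7] -/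
theorem exists_tendsto_kmIter_drStep [ProperSpace H] (hja : IsResolventMap γ A ja)
    (hjb : IsResolventMap γ B jb) (hA : IsMonotone A) (hB : IsMonotone B) (hγ : 0 < γ)
    (hzer : (zer (opSum A B)).Nonempty) {ρ : ℝ} (hρ0 : 0 < ρ) (hρ2 : ρ < 2) (z₀ : H) :
    ∃ z, drStep ja jb z = z ∧ jb z ∈ zer (opSum A B) ∧
      Tendsto (kmIter (drStep ja jb) ρ z₀) atTop (𝓝 z) ∧
      Tendsto (fun n => jb (kmIter (drStep ja jb) ρ z₀ n)) atTop (𝓝 (jb z)) := by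
  obtain ⟨x, hx⟩ := hzer
  obtain ⟨p, hp, -⟩ := exists_drStep_eq_self_of_mem_zer hja hjb hA hB hγ hx
  have hS := isMonotone_splitting hA hB hγ
  have hG := isResolventMap_drStep hja hjb hA hB hγ
  obtain ⟨q, hq, hlim⟩ := exists_tendsto_kmIter_resolvent hG hS one_pos
    ⟨p, (drStep_eq_self_iff hja hjb hA hB hγ).1 hp⟩ hρ0 hρ2 z₀
  have hq' : drStep ja jb q = q := (drStep_eq_self_iff hja hjb hA hB hγ).2 hq
  exact ⟨q, hq', apply_mem_zer_opSum_of_drStep_eq_self hja hjb hA hB hγ hq', hlim,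
    ((hjb.continuous hB hγ).tendsto q).comp hlim⟩

/-! ## The convex feasibility dictionary [LS20, §1.2–§1.3, §3] -/

/-- The **normal cone operator** of a set `C`: `N_C(x) = {y | ⟨y, c − x⟩ ≤ 0 ∀ c ∈ C}` for
`x ∈ C` and `N_C(x) = ∅` otherwise, as a subset of `H × H`. [cite: LindstromSims2020, §1.3] -/
def normalCone (C : Set H) : Set (H × H) := {p | p.1 ∈ C ∧ ∀ c ∈ C, ⟪p.2, c - p.1⟫ ≤ 0}

variable {C D : Set H} {y : H}

/-- Membership in `N_C`. [cite: LindstromSims2020, §1.3] -/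
theorem mem_normalCone_iff : (x, y) ∈ normalCone C ↔ x ∈ C ∧ ∀ c ∈ C, ⟪y, c - x⟫ ≤ 0 := Iff.rfl

/-- `dom N_C = C`. [cite: LindstromSims2020, §1.3] -/
theorem dom_normalCone (C : Set H) : dom (normalCone C) = C := by
  ext x
  constructor
  · rintro ⟨y, hy⟩; exact (mem_normalCone_iff.1 hy).1
  · intro hx; exact ⟨0, mem_normalCone_iff.2 ⟨hx, fun c _ => by rw [inner_zero_left]⟩⟩

/-- The normal cone operator is monotone. [cite: LindstromSims2020, §1.3] -/
theorem isMonotone_normalCone (C : Set H) : IsMonotone (normalCone C) := by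
  intro x y hxy x' y' hxy'
  obtain ⟨hx, h⟩ := mem_normalCone_iff.1 hxy
  obtain ⟨hx', h'⟩ := mem_normalCone_iff.1 hxy'
  have h1 := h x' hx'
  have h2 := h' x hx
  have e1 : ⟪x' - x, y⟫ = ⟪y, x' - x⟫ := real_inner_comm _ _
  have e2 : ⟪x' - x, y'⟫ = -⟪y', x - x'⟫ := by
    rw [← inner_neg_right, neg_sub, real_inner_comm]
  rw [inner_sub_right]
  linarith

/-- "The resolvents `J_{N_C}^λ` are the projection operators `P_C`": for `C` nonempty, complete
and convex and any `λ > 0`, the metric projection `proj C` is the resolvent map of `N_C`.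
[cite: LindstromSims2020, §1.3] -/
theorem isResolventMap_proj (hne : C.Nonempty) (hc : IsComplete C) (hC : Convex ℝ C)
    (hγ : 0 < γ) : IsResolventMap γ (normalCone C) (proj C) := by
  intro z
  refine mem_resolvent_iff.2
    ⟨γ⁻¹ • (z - proj C z), mem_normalCone_iff.2 ⟨proj_mem hne hc hC z, fun c hcC => ?_⟩, ?_⟩
  · rw [real_inner_smul_left]
    exact mul_nonpos_iff.2 (Or.inl ⟨inv_nonneg.2 hγ.le, inner_sub_proj_le_zero hne hc hC z hcC⟩)
  · rw [smul_smul, mul_inv_cancel₀ hγ.ne', one_smul, add_sub_cancel]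

/-- Hence `J_{λ N_C} = graph P_C` as operators. [cite: LindstromSims2020, §1.3] -/
theorem resolvent_normalCone_eq_graph_proj (hne : C.Nonempty) (hc : IsComplete C)
    (hC : Convex ℝ C) (hγ : 0 < γ) : resolvent γ (normalCone C) = graph (proj C) :=
  ((isResolventMap_proj hne hc hC hγ).graph_eq (isMonotone_normalCone C) hγ).symm

/-- The normal cone operator of a nonempty complete convex set is maximal monotone (its resolvent
`P_C` has full domain; footnote to [LS20, §1.3] and [EB92, Thm 2]).
[cite: LindstromSims2020, §1.3] -/
theorem isMaximalMonotone_normalCone (hne : C.Nonempty) (hc : IsComplete C) (hC : Convex ℝ C) :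
    IsMaximalMonotone (normalCone C) :=
  (isResolventMap_proj hne hc hC one_pos).isMaximalMonotone (isMonotone_normalCone C) one_pos

/-- The feasibility problem as a monotone inclusion: `zer(N_C + N_D) = C ∩ D` ("when the
operators in question are normal cone operators, the iterated process may be used to solve
feasibility problems"). [cite: LindstromSims2020, §1.3] -/
theorem zer_opSum_normalCone (C D : Set H) : zer (opSum (normalCone C) (normalCone D)) = C ∩ D := by
  ext x
  rw [mem_zer_opSum_iff]
  constructor
  · rintro ⟨b, hD, hC⟩
    exact ⟨(mem_normalCone_iff.1 hC).1, (mem_normalCone_iff.1 hD).1⟩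
  · rintro ⟨hC, hD⟩
    exact ⟨0, mem_normalCone_iff.2 ⟨hD, fun c _ => by rw [inner_zero_left]⟩,
      mem_normalCone_iff.2 ⟨hC, fun c _ => by rw [neg_zero, inner_zero_left]⟩⟩

/-- **[LS20, Definition 1.2]**: the Douglas–Rachford operator `T_{A,B} = ½(I + R_B R_A)` for two
sets, `R_C = 2P_C − I`, is the Douglas–Rachford step of [EB92] for the pair `(N_B, N_A)`
(`J_{N_B} = P_B` outside, `J_{N_A} = P_A` inside). [cite: LindstromSims2020, Def 1.2] -/
theorem drStep_proj_eq (A B : Set H) (x : H) :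
    drStep (proj B) (proj A) x
      = (1 / 2 : ℝ) •
        (x + ((2 : ℝ) • proj B ((2 : ℝ) • proj A x - x) - ((2 : ℝ) • proj A x - x))) :=
  drStep_eq_half_smul _ _ _

/-- **[LS20, Proposition 3.1] (fixed points of DR), convex case**: if `x ∈ Fix T_{A,B}` then
`P_A(x) ∈ A ∩ B` ("`x = x + P_B(2P_A x − x) − P_A x` and so `P_B(2P_A x − x) = P_A x`").
[cite: LindstromSims2020, Prop 3.1] -/
theorem proj_mem_inter_of_drStep_eq_self {A B : Set H} (hA : A.Nonempty) (hAc : IsComplete A)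
    (hAC : Convex ℝ A) (hB : B.Nonempty) (hBc : IsComplete B) (hBC : Convex ℝ B)
    (h : drStep (proj B) (proj A) x = x) : proj A x ∈ A ∩ B := by
  refine ⟨proj_mem hA hAc hAC x, ?_⟩
  have h2 : proj B ((2 : ℝ) • proj A x - x) = proj A x := by
    rw [drStep, ← eq_sub_iff_add_eq, sub_sub_cancel] at h
    exact h
  rw [← h2]
  exact proj_mem hB hBc hBC _

/-- **[LS20, Theorem 1.5] ([BCL04]) in finite dimension, with strong convergence**: for `A`, `B`
nonempty complete convex with `A ∩ B ≠ ∅`, the Douglas–Rachford iterates `x_{n+1} = T_{A,B} x_n`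
converge to some `x ∈ Fix T_{A,B}` with `P_A x ∈ A ∩ B`, and `P_A x_n → P_A x` (an instance of
[EB92, Cor 6.1] with `A ↝ N_B`, `B ↝ N_A`, `λ = 1`). [cite: LindstromSims2020, Thm 1.5] -/
theorem exists_tendsto_drIter_proj [ProperSpace H] {A B : Set H} (hA : A.Nonempty)
    (hAc : IsComplete A) (hAC : Convex ℝ A) (hB : B.Nonempty) (hBc : IsComplete B)
    (hBC : Convex ℝ B) (hAB : (A ∩ B).Nonempty) (x₀ : H) :
    ∃ x, drStep (proj B) (proj A) x = x ∧ proj A x ∈ A ∩ B ∧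
      Tendsto (drIter (proj B) (proj A) x₀) atTop (𝓝 x) ∧
      Tendsto (fun n => proj A (drIter (proj B) (proj A) x₀ n)) atTop (𝓝 (proj A x)) := by
  have hzer : (zer (opSum (normalCone B) (normalCone A))).Nonempty := by
    rw [zer_opSum_normalCone, Set.inter_comm]; exact hAB
  obtain ⟨x, hx, hmem, hlim, hlim'⟩ := exists_tendsto_drIter
    (isResolventMap_proj hB hBc hBC one_pos) (isResolventMap_proj hA hAc hAC one_pos)
    (isMonotone_normalCone B) (isMonotone_normalCone A) one_pos hzer x₀
  rw [zer_opSum_normalCone, Set.inter_comm] at hmem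
  exact ⟨x, hx, hmem, hlim, hlim'⟩

end Literature.Analysis.Convex.DouglasRachford

end
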